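import Summits.HodgeConjecture.HodgeConjecture.Theorems.F0P6cIsogenyDictionary   -- DICT ED. 1 (81cfdcf7): `PointDictionary`
import Literature.AlgebraicGeometry.Motives.SheetTransport                  -- ★ p845239 TRANSPORT (B-p18): `quot_kerF_of_cover` …
import Literature.AlgebraicGeometry.Motives.AbelianVarietyFrobeniusKernelBlocks   -- ★ p845240 (BLK): `relFrobeniusOver` for group schemes, criterion
import Literature.AlgebraicGeometry.GroupSchemes.HopfIdealOfClosedSubgroup      -- ★ `Alg`, `quotIncl`, `isHopfIdeal_ker_appTop`, `ker_appTop_quotIncl`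
import Literature.AlgebraicGeometry.GroupSchemes.ClosedSubgroupDichotomyHopf     -- ★ p845259 (K-b) DICHOTOMY-HOPF (F0P6-p10): `eq_or_etale_of_isHopfIdeal_of_stable`
import Literature.AlgebraicGeometry.GroupSchemes.FrobeniusKillsImage             -- ★ p845347 (K-c3) FROB-KILL (B-p17): `FrobKill.comp_relFrobeniusOver_eq_one_of_*`
import Literature.AlgebraicGeometry.GroupSchemes.AffineGroupSchemeBialgHom       -- ★ p845266 `ptEquiv_comp` (+ ★ `Alg.comap_apply`)
import Literature.AlgebraicGeometry.GroupSchemes.FrobeniusKernelUnitComponent   -- ★ p845457 (FKw-ord) (B-p08): K1 closer `ker_ptEquiv_le_ker_appTop_kerι_relFrobeniusOver_of_unitComponent`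
import Literature.AlgebraicGeometry.GroupSchemes.FrobeniusKernelIdealStable     -- ★ p845464 (A-p14): K0 closer `FrobKerIdeal.isHopfIdeal_and_finrank_and_map_le`
import Literature.AlgebraicGeometry.GroupSchemes.FrobeniusKillsQuotientSupersingular  -- ★ p845505 (B-p18) D3-ss: K3c closer `FrobKillSS.comp_relFrobeniusOver_eq_one_of_forall_not_isEtale`
import Literature.AlgebraicGeometry.GroupSchemes.FrobeniusKillsQuotientEtale          -- ★ p845810 (A-p14) D3-ét: K3b closer `FrobKillEt.comp_relFrobeniusOver_eq_one_of_isEtale`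
import Mathlib.AlgebraicGeometry.Morphisms.Etale
import HarnessLib

/-!
# `F0P6cDictConstructors` — ★ RE-HOME (rung-0 re-homing task, books INVENTORY §8.4 M-3; LEAD F0P6-plan (g4) «M-72») of the crux workfile `Lines/F0_P6c_DictConstructors.lean`

**SIZE-LINT SPLIT ×3** (`Theorems/` files with proofs are ≤ 400 lines): parts `Theorems/F0P6cDictConstructorsStubs.lean` → `Theorems/F0P6cDictConstructorsHead.lean` → `Theorems/F0P6cDictConstructors.lean`, each importing the previous, cut at declaration boundaries of `Lines/F0_P6c_DictConstructors.lean`; namespaces AND sections KEPT and re-opened per part (with their `open`∕`variable` lines replayed verbatim); the options preamble is repeated. This is PART 1.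

This `Theorems/` module is the TREE BYTES of `Summits/HodgeConjecture/HodgeConjecture/Cruxes/HLiu418/Lines/F0_P6c_DictConstructors.lean` (edition of record,
tree sha16 735e6ed4e9ab2185, 748 l., code-`sorry`-free) with the NAMESPACE KEPT — `Summit.HodgeConjecture.HodgeConjecture.Cruxes.HLiu418.F0P6cDictConstructors` — so that every
fully-qualified name (`kerFI`, `IsAdm`, `AdmSub`, `IdealIsEtale`, `isAdm_kerFI`, `unitIdeal_le_kerFI`, `exists_comp_quotIncl_eq_quotIncl_comp_of_isAdm`, `eq_kerFI_or_idealIsEtale_of_isAdm`, `comp_relFrobeniusOver_eq_one_of_isEtale`, `comp_relFrobeniusOver_eq_one_of_forall_not_isEtale`, …; 17 declarations) is UNCHANGED; only this module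
docstring is re-headed and the `Lines` imports are switched to their ★ re-homed twins (`F0_P6c_IsogenyDictionary` → `Theorems.F0P6cIsogenyDictionary`).  Why a re-home: a `Theorems/` file cannot import a `Lines/` workfile (F0P6-ref1 o-6), and closing
stmt-HodgeConjecture-24832 `--as proved --by <Theorems decl>` at rung 0 needs the sorry-free Lines chain behind the gate (RE-HOME MAP v1.1, LA7-plan (g4),
2026-09-02; director g27 s1336 (R1)–(R3)).    Lines importers of the original: `F0_P6a_ModuliDatumDefs`, `F0_P6c_HeckeBacktrack`.
After this file is ★ the Lines workfile is meant to become a one-import SHIM of it (a `Lines/` write, batched per cone on the LEAD's word), so no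
environment ever holds two copies (NO-CROSS-IMPORT rule, «M-72» (3)).  It asserts nothing beyond what the workfile already proves.

## Original module docstring (verbatim)
# F0 · P6c — CONSTRUCTORS of the isogeny dictionary: `heart_of_constructors : ⟨w-block data⟩ → PointDictionary … Kc P Fr red` and, ON GIVEN CARRIERS, `heart_of_carriers`
# (crux `HLiu418`, stmt-HodgeConjecture-24832; cell hodgecm-mathlib, P6 «MOD programme», sub-desk F0P6c-plan; ED. 1 (g2) + ED. 2 (g3: §4 `heart_of_carriers` APPENDED, §1–§3 token-identical) + ED. 3 (g3: §5 ED.-4 GLUE (5a)(5b)(6) APPENDED, §1–§4 token-identical), 2026-09-01)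

HC_CM is proved only modulo the printed citations (2 remaining named inputs hLiu418 24832, h413 24833) until rung 0 closes; this module
changes no count.  REGISTERED SKELETON (D-0175) of the ED.-4 constructor step of P6a՚s `stub_HEART` (LEAD M-12 (A1), M-13 (3)):

* §1 CARRIER CURRENCY (b) «Hopf ideals» (F0P6c-plan (g2) 15:45:46Z; A-p14 (g31) (ii)): for an affine group scheme `G` over a field `k`,
  `kerFI p f G` = the ideal of the kernel of the relative `q`-Frobenius `F^{(f)}_{G∕k}` (`q = p ^ f`; ★ `relFrobeniusOver`, ★ `GroupSchemeKernel.kerι`),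
  `IsAdm G β r I` = «`I` is a Hopf ideal with quotient of rank `r`, stable under the endomorphisms `β a`», `AdmSub G β r` the subtype,
  `IdealIsEtale G I` = «`Spec (Γ(G) ⧸ I) → Spec k` is étale».
* §2 FOUR SOCKETS, ALL PAID BY NAME (registered `stub_*` = ∅) + GLUE over ONE w-block `G` (generic `k`-group-scheme statements, no moduli
  word; each socket = one ★ organ dealt statement-first and landed `--supports 24832` within the edition): K0 `isAdm_kerFI` PAID (★ p845464: the Frobenius-kernel ideal is admissible), K1 `unitIdeal_le_kerFI` PAID (★ p845457: `ker F_G ⊆` unit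
  component), K3b `comp_relFrobeniusOver_eq_one_of_isEtale` PAID (★ p845810 A-p14 D3-ét `FrobKillEt`: FROB-KILL ét — an isogeny with ÉTALE
  admissible kernel is killed by the Frobenius of its target; ★ (K-c3) p845347 + ★ (o-c3j)), K3c `comp_relFrobeniusOver_eq_one_of_forall_not_isEtale` PAID (★ p845505 D3-ss: FROB-KILL ss); PAID: (b) `eq_kerFI_or_idealIsEtale_of_isAdm` := ★ (K-b) p845259 `eq_or_etale_of_isHopfIdeal_of_stable` (+ K0 + K1 + K2),
  K2 `exists_comp_quotIncl_eq_quotIncl_comp_of_isAdm` (ideal stability ⟹ `V(I)` stable), K4 `kerFI_le_ker_of_comp_relFrobeniusOver_eq_one`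
  (KILLS-FORM).
* §3 HEAD `heart_of_constructors` (sorry-free, `--axioms` TRIO-only): from the BINDER BLOCK «what P6a ED. 4 derives from its `ModuliDatum 𝔇`»
  (CONSTRUCTOR-SKELETON v0 §2, 95978bcbdb9e600f) — w-blocks `G₀ x̄` at the special points with unit components and ORD∕SS numerics, blocks `GΩ y`
  at the generic points, the moduli quotients `quot₀ quotΩ` and translations (D4∕D8), the `[ϖ]`-layer maps `isogW` of the quotient isogenies with
  D6 in KILLS-FORM, the sheet-twist transport data (D10, ★ SHEET-COVER p845161, ★ FROB-SHEET p845200), (c3a) ON THE IMAGE OF THE READING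
  `hHFimg` (= P6a `stub_HFROB`, FORM-I), (c2) and (b4′) as binders (★ p845223 ∕ A-p14 (ii) + B-p12 (K-b4), v2), (c1) = D7 verbatim — to
  `PointDictionary F ι₁ Jstar K₀ S hU7ₛ hJ hJu w hw Kc P Fr red`; (c3a) everywhere by ★ TRANSPORT `SheetTransport.quot_kerF_of_cover`.
* §4 HEAD ON GIVEN CARRIERS `heart_of_carriers` (ED. 2; sorry-free, `--axioms` TRIO-only): the SAME dictionary built ON P6a՚s ABSTRACT carriers `Line`,
  `Sub` (with their `kerF`, `IsEtale`) IDENTIFIED DOWNSTAIRS with the admissible ideals by `subEquiv x̄ : Sub x̄ ≃ AdmSub (G₀ x̄) (β₀ x̄) q`, `hkerF`,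
  `hIsEtale` (P6a D-4 «D3 DOWNSTAIRS»: `𝔇.subEquiv ∕ kerF_spec ∕ isEtale_spec`, LEAD M-17c); TWIST in `𝔇`՚s abstract form (`smap ∕ smap_kerF ∕
  quot_smap`); every other binder a field of `𝔇` VERBATIM or an organ row — so ED. 4՚s `stub_HEART` is ONE anonymous-constructor term and no
  carrier transport of `hecke` is ever written (upstairs `Line` is only a type family; §3՚s `GΩ ∕ βΩ` are not needed).
* §5 ED.-4 GLUE (ED. 3; sorry-free, frame-free): the two IN-DATUM derivations the ED.-4 junction needs besides the fields of `𝔇` —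
  (5a) `eq_kerF_or_isEtale_of_carriers`, the dichotomy (b) ON ABSTRACT CARRIERS (the last bullet of `heart_of_carriers`, exported: every `H : Sub x̄` is `kerF x̄`
  or étale), and (5b) `quot_kerF_eq_of_lines`, the EXTERNAL row `hHFimg : ∀ y, quot₀ (red y) (kerF (red y)) = Fr (red y)` of `heart_of_carriers` FROM
  HEART-FROB′ read on one sheet (`∀ y L, sp y L = kerF (red y) → red (quotΩ y L) = Fr (red y)`, i.e. P6a `𝔇.HeartFrob` + ★ p845200 (ii)) + `red_quotΩ` + a LINE
  THROUGH `kerF (red y)`: the canonical line at an ordinary point (`hKb4`), ANY line at a supersingular one ((5a): there every `H` is `kerF`) — whence the ONE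
  record-system input `Nonempty (Line y)` at supersingular `red y` (ref1 (g2) n35; from `𝔇.hecke`՚s bijection `Kc t₁ Kc ⁄ Kc ≃ Line (π x′)` at a deeper level
  + surjectivity of `π`, or a datum field).  ED. 4: `hHFimg := quot_kerF_eq_of_lines … (eq_kerF_or_isEtale_of_carriers …) 𝔇.block₀.canonicalLine₀ hne
  (fun y L h => (hHF σ hσ y L h).trans (hFrRed e y).symm)`.
  (6) `nonempty_line_of_hecke`: the `hne` supplier itself, BY NAME from the ★ record tower (LEAD (g2) 20:50:18Z ruling (b′): no new datum field) —
  a line at EVERY `y` from the `hhecke` row (finite Hecke orbits ★ `isHeckeTriple_top_of_isCompact_isOpen` + ★ `finite_orbit_quotient`; a common deeper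
  level ★ `C5.SmallLevel.exists_normal_le_forall_heckeLE`; `π : M_{N′} → M_{Kc}` surjective on `Ω`-points ★ `map_complexPoints_surjective` ⇒ ★
  `surjective_left_of_forall_algPoints` ⇒ ★ `exists_algPoints_comp_eq_of_surjective`); ED. 4: `hne := fun y _ => nonempty_line_of_hecke F ι₁ Jstar K₀ S hU7ₛ hJ
  hJu w hw Kc 𝔇.Line 𝔇.quotΩ 𝔇.translΩ 𝔇.hecke y` — so `stub_HEART` is ONE TERM modulo `hcover` (★ SHEET-COVER p845161) ALONE.

Sorries: NONE (ED. 1, ED. 2 and ED. 3; the open work is the ED.-4 binder block, derivation column in the card).  No instance, no notation,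
no axiom.  Imports DICT + ★ only (never P6a՚s files: P6a ED. 4 imports THIS one).
[cite: Liu2021, Prop. D.8 p. 135, pp. 136–138] [cite: HarrisTaylorAMS2001, §III.4, pp. 108–110] [cite: Tate1997FiniteFlatGroupSchemes, (3.7)]
[cite: SGA3I, VII_A 4.1] -/

set_option autoImplicit false

noncomputable section


namespace Summit.HodgeConjecture.HodgeConjecture.Cruxes.HLiu418.F0P6cDictConstructors

set_option linter.dupNamespace false  -- `Summit.HodgeConjecture.HodgeConjecture.…` BY DESIGN (D-0017)

open CategoryTheory CategoryTheory.Limits AlgebraicGeometry MonoidalCategory CartesianMonoidalCategory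
open NumberField IsDedekindDomain MulAction Polynomial
open scoped Matrix MonObj Obj
open Literature.NumberTheory.GaloisRepresentations
open Literature.NumberTheory.Automorphic Literature.NumberTheory.Automorphic.UnitaryGroup
open Literature.AlgebraicGeometry.ShimuraVarieties.UnitaryCanonicalModel
open Literature.NumberTheory.Automorphic.Liu2021.AppendixC
open Literature.AlgebraicGeometry.Motives (AlgPoints SchemeOver specOver relFrobeniusOver frobeniusTwistOver)
open Literature.AlgebraicGeometry.GroupSchemes (eq_or_etale_of_isHopfIdeal_of_stable)
open Literature.AlgebraicGeometry.GroupSchemes.AffineGroupScheme (Alg quotIncl ptEquiv isoSpecOver ptEquiv_comp ptEquiv_quotIncl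
  exists_comp_quotIncl_eq_iff_le_ker Alg.comap_apply)
open Literature.AlgebraicGeometry.GroupSchemes.GroupSchemeKernel (ker kerι kerLift kerLift_ι)
open Summit.HodgeConjecture.HodgeConjecture.Cruxes.HLiu418.F0P6cIsogenyDictionary (PointDictionary)

universe v

/-! ### §1 Carrier currency (b): admissible Hopf ideals, the Frobenius-kernel ideal, étaleness -/

section Carriers

variable {k : Type} [Field k] (p f : ℕ) [ExpChar k p] (G : SchemeOver k) [GrpObj G] [IsAffine G.left]

/-- The IDEAL of the kernel of the relative `q`-Frobenius `F^{(f)}_{G∕k} : G → G^{(p^f)}` (★ `relFrobeniusOver`, transported group structure on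
the twist under `open scoped Obj`; ★ `GroupSchemeKernel.kerι`): `ker Γ(kerι)`.  DICT՚s `kerF x̄` is `⟨kerFI p f (G₀ x̄), _⟩`. [cite: SGA3I, VII_A 4.1] -/
def kerFI : Ideal (Alg G) :=
  (RingHom.ker (kerι (relFrobeniusOver p f G)).left.appTop.hom : Ideal (Alg G))

variable {σ : Type*} (β : σ → (G ⟶ G)) (r : ℕ)

/-- ADMISSIBLE ideals: Hopf ideals (★ Mathlib `Ideal.IsHopfIdeal`) whose quotient has `k`-rank `r` and which are stable under the algebra maps
of the endomorphisms `β a` (print: `𝒪_F`-stable closed subgroup schemes of order `N w` of `𝒢_t[ϖ]`). [cite: Tate1997FiniteFlatGroupSchemes, (3.7)] -/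
def IsAdm (I : Ideal (Alg G)) : Prop :=
  I.IsHopfIdeal k ∧ Module.finrank k (Alg G ⧸ I) = r ∧ ∀ a : σ, I.map (β a).left.appTop.hom ≤ I

/-- The carrier `Sub t` ∕ `Line y` of DICT in currency (b): the subtype of admissible ideals (EXTENSIONAL — equality of members is equality of
ideals, as (b) `eq_kerF_or_isEtale` and (b4′) `canonicalLine` require). [cite: Tate1997FiniteFlatGroupSchemes, (3.7)] -/
def AdmSub : Type :=
  {I : Ideal (Alg G) // IsAdm G β r I}

/-- ÉTALENESS of the closed subgroup scheme an ideal cuts out: `Spec (Γ(G) ⧸ I) → Spec k` étale (★ `quotIncl G I` is that closed subgroup).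
[cite: Tate1997FiniteFlatGroupSchemes, (3.7)] -/
def IdealIsEtale (I : Ideal (Alg G)) : Prop :=
  Etale (specOver k (Alg G ⧸ I)).hom

end Carriers

/-! ### §2 The constructor lemmas over ONE w-block (generic `k`-group-scheme statements): registered stubs + paid glue -/

section Stubs

variable {k : Type} [Field k] [IsAlgClosed k] (p f : ℕ) [Fact p.Prime] [CharP k p] [ExpChar k p]

omit [IsAlgClosed k] [Fact p.Prime] [CharP k p] in
/-- **K0 (PAID by ★ p845464, A-p14 (g31)) — the Frobenius-kernel ideal is admissible**.  Hopf: ★ `isHopfIdeal_ker_appTop` (`kerι` a homomorphic closed immersion: ★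
`isMonHom_kerι`, ★ `isClosedImmersion_kerι_left_of_isSeparated`, ★ `FrobKill.isMonHom_relFrobeniusOver`); stability: naturality ★
`relFrobeniusOver_comp_map` + ★ `kerLift` + ★ `exists_comp_eq_iff_ker_appTop_le`; rank: the hypothesis `hrkF` (w-block input D3).
[cite: SGA3I, VII_A 4.1] -/
theorem isAdm_kerFI (G : SchemeOver k) [GrpObj G] [IsAffine G.left]
    {σ : Type*} (β : σ → (G ⟶ G)) (hβ : ∀ a, IsMonHom (β a))
    (hrkF : Module.finrank k (Alg G ⧸ kerFI p f G) = p ^ f) :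
    IsAdm G β (p ^ f) (kerFI p f G) :=
  Literature.AlgebraicGeometry.GroupSchemes.FrobKerIdeal.isHopfIdeal_and_finrank_and_map_le p f β hβ hrkF

omit [IsAlgClosed k] [Fact p.Prime] [CharP k p] in
/-- **K1 (PAID by ★ p845457, B-p08 (g30)) — the Frobenius kernel lies in the unit component**: the ideal of the unit component `U ↪ G` (★ (E-b)∕(K-b) currency
`ker (ptEquiv G (Alg U) (isoSpecOver⁻¹ ≫ jU))`, = `ker Γ(jU)` by ★ `ker_ptEquiv_isoSpecOver_inv_comp_eq`) is contained in the Frobenius-kernel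
ideal, i.e. `ker F_G ⊆ U`: `ker F_G` has ONE point (★ `relFrobeniusOver_base_bijective` ∕ `subsingleton_ker_left_of_injective`), hence is
connected (★ `connectedSpace_left_of_subsingleton`) and its inclusion factors through the clopen `U` (★ `ConnectedFactorsThroughUnitComponent.
existsUnique_fac_hom`); then ★ `exists_comp_eq_iff_ker_appTop_le`.  = hypothesis `hK₀` of ★ `eq_or_etale_of_isHopfIdeal_of_stable`.
[cite: Tate1997FiniteFlatGroupSchemes, (3.7)] -/
theorem unitIdeal_le_kerFI (G : SchemeOver k) [GrpObj G] [IsAffine G.left] [IsFinite G.hom]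
    (U : SchemeOver k) [GrpObj U] [IsAffine U.left] (jU : U ⟶ G)
    (hU : IsMonHom jU ∧ IsOpenImmersion jU.left ∧ IsClosedImmersion jU.left ∧ ConnectedSpace ↥U.left) :
    RingHom.ker (ptEquiv G (Alg U) ((isoSpecOver U).inv ≫ jU)).toRingHom ≤ kerFI p f G :=
  Literature.AlgebraicGeometry.GroupSchemes.ker_ptEquiv_le_ker_appTop_kerι_relFrobeniusOver_of_unitComponent p f G U jU hU

omit [IsAlgClosed k] in
/-- **K2 (paid glue) — ideal stability ⟹ the closed subgroup `V(I)` is stable**: `I·Γ(β a) ⊆ I` gives a factorisation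
`V(I) ≫ β a = v ≫ V(I)` (★ `exists_comp_quotIncl_eq_iff_le_ker`, ★ `ptEquiv_comp`, ★ `ptEquiv_quotIncl`, ★ `Alg.comap_apply`).  = hypothesis
`hstab` of ★ `eq_or_etale_of_isHopfIdeal_of_stable`. [cite: GortzWedhorn2023, (27.1.1)] -/
theorem exists_comp_quotIncl_eq_quotIncl_comp_of_isAdm (G : SchemeOver k) [GrpObj G] [IsAffine G.left]
    {σ : Type*} (β : σ → (G ⟶ G)) (r : ℕ) (I : Ideal (Alg G)) (hI : IsAdm G β r I) (a : σ) :
    ∃ v : specOver k (Alg G ⧸ I) ⟶ specOver k (Alg G ⧸ I), v ≫ quotIncl G I = quotIncl G I ≫ β a := by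
  refine (exists_comp_quotIncl_eq_iff_le_ker G I (quotIncl G I ≫ β a)).mpr fun x hx => ?_
  rw [RingHom.mem_ker, AlgHom.toRingHom_eq_coe, AlgHom.coe_toRingHom, ptEquiv_comp, AlgHom.comp_apply, ptEquiv_quotIncl,
    Alg.comap_apply, Ideal.Quotient.mkₐ_eq_mk]
  exact Ideal.Quotient.eq_zero_iff_mem.mpr (hI.2.2 a (Ideal.mem_map_of_mem _ hx))

/-- **(b) DICHOTOMY — PAID** (K0 ★ p845464, K1 ★ p845457): every admissible ideal of a w-block is the Frobenius-kernel ideal or étale, by ★ (K-b)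
p845259 `eq_or_etale_of_isHopfIdeal_of_stable` (F0P6-p10 (g0); engine ★ (E-b) p845148 + ★ (o-c3m) p845089) fed with `K := kerFI` (Hopf by
K0 ★ p845464, inside `U` by K1 ★ p845457, rank `q` = `hrkF`) and the stability of `V(I)` (K2). [cite: Tate1997FiniteFlatGroupSchemes, (3.7)]
[cite: HarrisTaylorAMS2001, Lemma II.2.1] -/
theorem eq_kerFI_or_idealIsEtale_of_isAdm (G : SchemeOver k) [GrpObj G] [IsAffine G.left] [IsFinite G.hom]
    {σ : Type*} (β : σ → (G ⟶ G)) (hβ : ∀ a, IsMonHom (β a))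
    (U : SchemeOver k) [GrpObj U] [IsAffine U.left] (jU : U ⟶ G)
    (hU : IsMonHom jU ∧ IsOpenImmersion jU.left ∧ IsClosedImmersion jU.left ∧ ConnectedSpace ↥U.left)
    (NU : ℕ) (θU : (k[X] ⧸ Ideal.span {(X : k[X]) ^ (p ^ NU)}) ≃ₐ[k] Alg U)
    (hrkF : Module.finrank k (Alg G ⧸ kerFI p f G) = p ^ f)
    (hpts : Nat.card (𝟙_ (SchemeOver k) ⟶ G) = 1 ∨ Nat.card (𝟙_ (SchemeOver k) ⟶ G) = p ^ f)
    (hsimple : ∀ Λ : Subgroup (𝟙_ (SchemeOver k) ⟶ G), (∀ a, ∀ g ∈ Λ, g ≫ β a ∈ Λ) → Λ = ⊥ ∨ Λ = ⊤)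
    (I : Ideal (Alg G)) (hI : IsAdm G β (p ^ f) I) :
    I = kerFI p f G ∨ IdealIsEtale G I := by
  haveI : I.IsHopfIdeal k := hI.1
  haveI : (kerFI p f G).IsHopfIdeal k := (isAdm_kerFI p f G β hβ hrkF).1
  exact eq_or_etale_of_isHopfIdeal_of_stable jU hU θU β hsimple hpts (kerFI p f G) (unitIdeal_le_kerFI p f G U jU hU) hrkF
    I hI.2.1 (exists_comp_quotIncl_eq_quotIncl_comp_of_isAdm G β (p ^ f) I hI)

omit [Fact p.Prime] [CharP k p] in
/-- **K3b (PAID by ★ p845810, A-p14 (g31), organ `FrobKillEt`) — FROB-KILL (étale kernel)**: an isogeny of w-blocks `φ : G → G′` killing an ÉTALE admissible `V(I) ⊆ G` satisfies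
`φ ≫ F_{G′} = 1`.  Closer: `V(I)` étale of rank `q` has `q` points, so `#G(k) ≥ q`, `rank U = rank G ∕ #G(k) ≤ q` (★ b1c ∕ `UnitComponentRank`),
and `ker F_G ⊆ U` (K1 ★ p845457) of rank `q` (`hrkF`) forces `U = ker F_G`, i.e. `jU ≫ F_G = 1`; `U × V(I) ⥲ G` (★ (o-c3j) p845054
`isIso_tensorHom_comp_mul_of_etale`, ranks `q·q = q²` = `hrkG`); conclude by ★ (K-c3) p845347 `FrobKill.comp_relFrobeniusOver_eq_one_of_epi_tensorHom_mul`.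
[cite: Tate1997FiniteFlatGroupSchemes, (3.7)] [cite: SGA3I, VII_A 4.1] -/
theorem comp_relFrobeniusOver_eq_one_of_isEtale (G G' : SchemeOver k) [GrpObj G] [IsCommMonObj G] [IsAffine G.left]
    [IsFinite G.hom] [GrpObj G'] [IsAffine G'.left]
    {σ : Type*} (β : σ → (G ⟶ G))
    (U : SchemeOver k) [GrpObj U] [IsAffine U.left] (jU : U ⟶ G)
    (hU : IsMonHom jU ∧ IsOpenImmersion jU.left ∧ IsClosedImmersion jU.left ∧ ConnectedSpace ↥U.left)
    (hrkG : Module.finrank k (Alg G) = p ^ f * p ^ f) (hrkF : Module.finrank k (Alg G ⧸ kerFI p f G) = p ^ f)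
    (φ : G ⟶ G') [IsMonHom φ] (I : Ideal (Alg G)) (hI : IsAdm G β (p ^ f) I) (hIet : IdealIsEtale G I)
    (hφ : quotIncl G I ≫ φ = 1) :
    φ ≫ relFrobeniusOver p f G' = 1 :=
  Literature.AlgebraicGeometry.GroupSchemes.FrobKillEt.comp_relFrobeniusOver_eq_one_of_isEtale p f G G' U jU hU hrkG hrkF φ I hI.1
    hI.2.1 hIet hφ

set_option synthInstance.maxHeartbeats 400000 in
omit [CharP k p] in
/-- **K3c (PAID by ★ p845505, B-p18 (g35)) — FROB-KILL (supersingular)**: if the w-block `G` has NO étale admissible ideal, an isogeny `φ : G → G′` killing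
`V(kerFI) = ker F_G` satisfies `φ ≫ F_{G′} = 1`.  Closer: an étale admissible ideal exists as soon as `#G(k) = q` (the points ideal: ★
`isHopfIdeal_ker_pi`, ★ `etale_specOver_quotient_ker_hom`, ★ (K-b4) p845304 `etale_quotIncl_pointsIdeal_of_subgroup`, rank `q`, `β`-stable since
`β a` permutes points), so `#G(k) = 1` (`hpts`), `G` is connected and `jU` an isomorphism (★ μ3 ∕ `UnitComponentClopen`), `hFFU` becomes
`F_G ≫ F_{G^{(q)}} = 1`, and ★ (K-c3) p845347 `FrobKill.comp_relFrobeniusOver_eq_one_of_kerι_comp_eq_one` concludes (`kerι` vs `quotIncl (kerFI)`: ★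
`exists_iso_comp_quotIncl_ker_appTop_eq`). [cite: SGA3I, VII_A 4.1] [cite: GortzWedhorn2020, Definition 4.45 (2)] -/
theorem comp_relFrobeniusOver_eq_one_of_forall_not_isEtale (G G' : SchemeOver k) [GrpObj G] [IsCommMonObj G]
    [IsAffine G.left] [IsFinite G.hom] [GrpObj G'] [IsAffine G'.left]
    {σ : Type*} (β : σ → (G ⟶ G))
    (U : SchemeOver k) [GrpObj U] [IsAffine U.left] (jU : U ⟶ G)
    (hU : IsMonHom jU ∧ IsOpenImmersion jU.left ∧ IsClosedImmersion jU.left ∧ ConnectedSpace ↥U.left)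
    (hFFU : jU ≫ relFrobeniusOver p f G ≫ relFrobeniusOver p f (frobeniusTwistOver p f G) = 1)
    (hpts : Nat.card (𝟙_ (SchemeOver k) ⟶ G) = 1 ∨ Nat.card (𝟙_ (SchemeOver k) ⟶ G) = p ^ f)
    (hnone : ∀ I : Ideal (Alg G), IsAdm G β (p ^ f) I → ¬ IdealIsEtale G I)
    (φ : G ⟶ G') [IsMonHom φ] (hφ : quotIncl G (kerFI p f G) ≫ φ = 1) :
    φ ≫ relFrobeniusOver p f G' = 1 :=
  Literature.AlgebraicGeometry.GroupSchemes.FrobKillSS.comp_relFrobeniusOver_eq_one_of_forall_not_isEtale p f G G' β U jU hU hFFU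
    hpts hnone φ hφ

omit [IsAlgClosed k] [Fact p.Prime] [CharP k p] in
/-- **K4 (paid glue) — KILLS-FORM**: `φ ≫ F_{G′} = 1` ⟹ the Frobenius-kernel ideal of `G′` dies under `Γ(φ)` (`φ` factors through `ker F_{G′}`:
★ `GroupSchemeKernel.kerLift_ι`).  Feeds D6 `hD6`. [cite: SGA3I, VII_A 4.1] -/
theorem kerFI_le_ker_of_comp_relFrobeniusOver_eq_one {G G' : SchemeOver k} [GrpObj G'] [IsAffine G'.left]
    (φ : G ⟶ G') (h : φ ≫ relFrobeniusOver p f G' = 1) :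
    kerFI p f G' ≤ (RingHom.ker φ.left.appTop.hom : Ideal (Alg G')) := by
  intro x hx
  have hx' : (kerι (relFrobeniusOver p f G')).left.appTop.hom x = 0 := hx
  show φ.left.appTop.hom x = 0
  rw [← kerLift_ι φ h, Over.comp_left, Scheme.Hom.comp_appTop, CommRingCat.hom_comp, RingHom.comp_apply, hx',
    map_zero]

end Stubs

end Summit.HodgeConjecture.HodgeConjecture.Cruxes.HLiu418.F0P6cDictConstructors
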